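import Summits.QuantumFields.QCD.Theses.SpectralDefectExtinction
import Literature.MathematicalPhysics.QuantumFieldTheory.QCDPhaseQuenchedPositivity
import Summits.QuantumFields.QCD.Theorems.SpectralDefectExtinctionWindowExtinctionCellSpreadErdosLittlewoodOfford
import Summits.QuantumFields.QCD.Theorems.SpectralDefectExtinctionWindowExtinctionCellSpreadWindowToMoment
import Summits.QuantumFields.QCD.Theorems.SpectralDefectExtinctionWindowExtinctionCellSpreadCoFactorisation
import Summits.QuantumFields.QCD.Theorems.SpectralDefectExtinctionWindowExtinctionCellSpreadNegCountBlockDiagonal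
import Summits.QuantumFields.QCD.Theorems.SpectralDefectExtinctionWindowExtinctionCellSpreadIndexMeasurable

/-!
# Line `Sketch` (crux idea `wall-conditioned-cell-spread`) — reduction skeleton for the restated crux
# `WindowExtinction` = SD⁺ (stmt-QuantumFields-18063, route `SpectralDefectExtinction`)

Lead seat `prover-line-stmt-QuantumFields-18063-0`, cycle 1 (2026-08-17); continued by `prover-line-stmt-QuantumFields-18063-c1-0` (r3, 2026-08-17: landed stubs imported).  Written by the lead from the card
`Cruxes/WindowExtinction/Ideas/wall-conditioned-cell-spread.md` (the planner's `Sketch.lean` is a Props-only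
first-lemma file and is not readable in this seat's jail; see `PICKED.md`).

## Architecture (`WindowExtinction_of`)

TIGHT⁺ (`E₊|index| ≥ max(1, η (a_k(2L_k+1))²)`) is the whole junk-excluding content of SD⁺
(`Negative/NearTipBand`).  The card's mechanism: condition on a grid of walls; the Wilson action is
nearest-neighbour, so cell interiors are independent given the walls; ONE Schur complement w.r.t. the wall
block carries both the phase-quenched weight `∏_f |det|` and the index `n₋`; so, given the walls and off a
resonance event, the index is `C(walls) + Σ_i ζ_i` with conditionally independent integer cell charges
`ζ_i` (up to a density factor `e^{±τ}`), each spread at scale `d = c s²`; Erdős–Littlewood–Offord then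
bounds every window of the index law and the window-covering arithmetic (card F1) turns that into the
first-moment floor with `η` FIXED.  This file makes the abstract half a theorem modulo two generic stubs
and isolates the lattice half in one stub:

* §A  `stub_erdosLittlewoodOfford` (S1; abstract, finite product-weight form, unequal steps `≥ d`, windows
  of length `d`, two atoms of mass `≥ p`; Sperner) and `stub_windowToMoment` (S2; abstract measure theory:
  window masses `≤ (δ + Jκ)·Z` for intervals of length `J d` ⇒ `((Jd/2 − 1)(1 − δ − Jκ))·Z ≤ ∫ |X| w`).
* §B  the deterministic cell calculus the lattice stub consumes when it is split (registered now so that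
  workers can land it): `stub_coFactorisation` (S3: `|det|` and `n₋` of a Hermitian block matrix through the
  Schur complement of an invertible Hermitian corner), `stub_negCountBlockDiagonal` (S4: `n₋` is additive over
  block-diagonal families), `stub_negCountStableUnderGap` (S5: Weyl — `n₋` is unchanged by a Hermitian
  perturbation of operator norm `≤ ε` when `[−ε, ε]` is free of eigenvalues).
* §C  `stub_wallCellDomination` (S6, THE lattice statement = card T1 ∧ T2 ∧ T3 ∧ T5 + DLR/Fubini + the
  lattice instance of S3–S5): an admissible, capped, branched regularisation with EXTINCT verbatim whose
  phase-quenched index law at every probe `M > M₀` is, eventually in `k` and off an event of PQ-mass `≤ 1/4`,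
  dominated interval-by-interval by `e^τ ×` the worst product of `N_k` two-atom `(d_k, p)`-spread laws, with
  `c₂ (a_k(2L_k+1))² ≤ d_k √(N_k+1)` and `N_k → ∞`.
* §D  `WindowExtinction_of : WindowExtinction` from S1 + S2 + S6 (pure bookkeeping, proved here):
  `η := c₂ / (32 e^τ C(p))`.

All stub signatures are DEF-FREE (fully inlined) so that each can be landed verbatim under `Theorems/` with
`--supports stmt-QuantumFields-18063` without a reviewed Defs file.

Imports (r1–r2): ONLY the route file.  Reason (infrastructure alarm, 2026-08-17; r3 imports the six landed CellSpread modules, which import only Mathlib / Literature / ChiralInertia): `Theorems/ExtinctionBuildsQCD/Negative/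
WithoutTightCollapse.lean` §0 is `Iff.rfl` against the pre-restate bodies and no longer elaborates, so its importers
(`negRootCount`, Haynsworth, SpectralFlow, `stub_negCountMeasurable`, `TightPlusOfMoments`, `NearTipBand`, …) are
unbuilt on the farm; counts are therefore written inline as `Multiset.countP (fun z => z.re < 0) (charpoly …).roots`.
-/

noncomputable section

namespace Summit.QuantumFields.QCD.Cruxes.WindowExtinction.WallConditionedCellSpread

open scoped BigOperators Topology Classical MeasureTheory Matrix ComplexConjugate
open Filter MeasureTheory Matrix
open Literature.MathematicalPhysics.QuantumLattice Literature.MathematicalPhysics.QuantumFieldTheory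
  Literature.Probability.LatticeModels
open Summit.QuantumFields.QCD.Theses.SpectralDefectExtinction

/-! ## §A–§B  Stubs S1–S5, S7: ALL LANDED (p138368 S1, p138628 S2, p138869 S3, p139005 S4, p139602 S5, p139854 S7).
S1–S4 and S7 are IMPORTED above from `Theorems/SpectralDefectExtinctionWindowExtinctionCellSpread*.lean` (same namespace,
registered signatures verbatim).  S5 (`stub_negCountStableUnderGap`, landed p139602 in
`Theorems/SpectralDefectExtinctionWindowExtinctionCellSpreadNegCountStableUnderGap.lean`, an ingredient of S6 not used by
the composition) is not imported only because that module is not yet built in the farm snapshot (`remote:stale:unbuilt`,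
2026-08-17T04:10Z).  The only `sorry` of this file is the open stub S6. -/

/-! ## §C  The lattice statement (card T1 ∧ T2 ∧ T3 ∧ T5 + DLR/Fubini + lattice instance of §B) -/

/-- **S6 — wall/cell domination of the phase-quenched index law (THE lattice stub).**
There is a mass-scaling, asymptotically scaling, polynomially capped, branched regularisation `reg` with
threshold `M₀ ≥ 0` and window constant `c > 0` such that for every mass tuple `m > M₀`:
(i) EXTINCT (verbatim from the route file); (ii) for some `p, τ, c₂ > 0`, every probe `M > M₀` and every
`n₀`, eventually in `k`: for the weight `w_k = ∏_f ‖det D_W(U, m_f(k), 1)‖` (PQ partition function `Z_k = ∫ w_k`)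
and the index `X_k = n₋(Γ₅D_W(U, m_crit(k) − a_kM/Z_k, 1)) − 6(2L_k+1)⁴`, there are `N ≥ n₀` cells and a step `d ≥ 1` with `c₂ (a_k(2L_k+1))² ≤ d √(N+1)` such that for
every `κ ≥ 0` bounding all `[y, y+d)`-window masses of all products of `N` two-atom `(d, p)`-spread
probability weights (the hypothesis of S1's conclusion), every interval `[x, x + J d)` of the index receives
PQ-mass `≤ (1/4 + J e^τ κ) · Z_k`.  Content: condition on walls of width `W_k ≍ Z_k log(1/a_k)/min(m, M)`;
Markov property of the plaquette action; `|det|` and `n₋` through the wall Schur complement (S3), cells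
decoupled up to `e^{±τ}` by Combes–Thomas through typical walls at the sea masses (T1, T2) and additively in
`n₋` off probe resonances of PQ-mass `≤ 1/4` (T3, S4, S5); per-cell two-atom spread `(c s_k², p)` of the cell
charge under the tilted cell law (T5); `N ≍ (a_k(2L_k+1)/s_k)⁴`. -/
theorem stub_wallCellDomination :
    ∀ Nf : ℕ, (Nf = 2 ∨ Nf = 3) → ∃ reg : QCDRegularisation Nf, reg.HasMassScaling ∧
      (reg.scheme 0 0 0).HasAsymptoticScaling ∧
      (∃ p : ℕ, ∀ᶠ k : ℕ in Filter.atTop, (reg.L k : ℝ) ≤ (reg.a k)⁻¹ ^ p) ∧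
      (∀ᶠ k : ℕ in Filter.atTop, -1 < reg.mcrit k) ∧
      ∃ M₀ : ℝ, 0 ≤ M₀ ∧ ∃ c : ℝ, 0 < c ∧ ∀ m : Fin Nf → ℝ, (∀ f, M₀ < m f) →
        (∀ ε : ℝ, 0 < ε → ∀ᶠ k : ℕ in Filter.atTop, ∀ S : ℕ, reg.L k ≤ S → (∫ U, ((∑ f : Fin Nf, ((Multiset.countP (fun z : ℂ => z.im = 0 ∧ z.re < -(reg.mcrit k + reg.a k * m f / reg.Zm k)) (wilsonDirac (fundamentalRep (Fin 3)) U 0 1).charpoly.roots : ℝ) + (Multiset.countP (fun z : ℂ => |z.re| < c * (reg.a k * m f / reg.Zm k)) (spinorLift gammaFive * wilsonDirac (fundamentalRep (Fin 3)) U (reg.mcrit k + reg.a k * m f / reg.Zm k) 1).charpoly.roots : ℝ)))) * ∏ f : Fin Nf, ‖fermionDet (wilsonDirac (fundamentalRep (Fin 3)) U (reg.mcrit k + reg.a k * m f / reg.Zm k) 1)‖ ∂(wilsonMeasure (d := 4) (L := 2 * S + 1) (fundamentalRep (Fin 3)) (reg.β k))) / (∫ U, ∏ f : Fin Nf, ‖fermionDet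 (wilsonDirac (fundamentalRep (Fin 3)) U (reg.mcrit k + reg.a k * m f / reg.Zm k) 1)‖ ∂(wilsonMeasure (d := 4) (L := 2 * S + 1) (fundamentalRep (Fin 3)) (reg.β k))) ≤ ε * ((2 * S + 1 : ℝ) / (2 * reg.L k + 1)) ^ 4) ∧
        ∃ p : ℝ, 0 < p ∧ ∃ τ : ℝ, 0 < τ ∧ ∃ c₂ : ℝ, 0 < c₂ ∧ ∀ M : ℝ, M₀ < M → ∀ n₀ : ℕ, ∀ᶠ k : ℕ in Filter.atTop,
          ∃ N : ℕ, n₀ ≤ N ∧ ∃ d : ℕ, 0 < d ∧ c₂ * (reg.a k * (2 * reg.L k + 1 : ℝ)) ^ 2 ≤ d * Real.sqrt (N + 1) ∧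
            ∀ κ : ℝ, 0 ≤ κ →
              (∀ (supp : Finset ℤ) (f : Fin N → ℤ → ℝ), (∀ i z, 0 ≤ f i z) → (∀ i, ∑ z ∈ supp, f i z = 1) →
                (∀ i, ∃ u ∈ supp, ∃ v ∈ supp, u + d ≤ v ∧ p ≤ f i u ∧ p ≤ f i v) →
                ∀ y : ℤ, (∑ z ∈ (Fintype.piFinset fun _ : Fin N => supp) with (y ≤ ∑ i, z i ∧ ∑ i, z i < y + d),
                  ∏ i, f i (z i)) ≤ κ) →
              ∀ (x : ℤ) (J : ℕ),
                ∫ U in {U : GaugeConfig 4 (2 * reg.L k + 1) (Matrix.specialUnitaryGroup (Fin 3) ℂ) | x ≤ ((Multiset.countP (fun z : ℂ => z.re < 0) (spinorLift gammaFive * wilsonDirac (fundamentalRep (Fin 3)) U (reg.mcrit k - reg.a k * M / reg.Zm k) 1).charpoly.roots : ℕ) : ℤ) - 6 * (2 * (reg.L k : ℤ) + 1) ^ 4 ∧ ((Multiset.countP (fun z : ℂ => z.re < 0) (spinorLift gammaFive * wilsonDirac (fundamentalRep (Fin 3)) U (reg.mcrit k - reg.a k * M / reg.Zm k) 1).charpoly.roots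 : ℕ) : ℤ) - 6 * (2 * (reg.L k : ℤ) + 1) ^ 4 < x + J * d},
                  ∏ f : Fin Nf, ‖fermionDet (wilsonDirac (fundamentalRep (Fin 3)) U (reg.mcrit k + reg.a k * m f / reg.Zm k) 1)‖ ∂(wilsonMeasure (d := 4) (L := 2 * reg.L k + 1) (fundamentalRep (Fin 3)) (reg.β k))
                ≤ (1 / 4 + J * (Real.exp τ * κ)) * ∫ U, ∏ f : Fin Nf, ‖fermionDet (wilsonDirac (fundamentalRep (Fin 3)) U (reg.mcrit k + reg.a k * m f / reg.Zm k) 1)‖ ∂(wilsonMeasure (d := 4) (L := 2 * reg.L k + 1) (fundamentalRep (Fin 3)) (reg.β k)) := by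
  sorry

/-! ## §D  Composition -/

/-- The physical side `a_k (2L_k+1)` tends to `∞` along any regularisation (`a_k L_k → ∞`, `a_k > 0`). -/
theorem tendsto_side {Nf : ℕ} (reg : QCDRegularisation Nf) :
    Tendsto (fun k => reg.a k * (2 * reg.L k + 1 : ℝ)) atTop atTop := by
  refine tendsto_atTop_mono (fun k => ?_) reg.tendsto_L
  have ha := (reg.a_pos k).le
  have hL : (reg.L k : ℝ) ≤ 2 * reg.L k + 1 := by
    have : (0 : ℝ) ≤ reg.L k := Nat.cast_nonneg _
    linarith
  exact mul_le_mul_of_nonneg_left hL ha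

/-- **The composition: S1 + S2 + S6 ⇒ the crux `WindowExtinction` (SD⁺).**
EXTINCT, the scalings, the cap and the branch clause come verbatim from S6; TIGHT⁺ with
`η = c₂ / (32 e^τ C(p))`: at probe `M`, take `n₀` with `√(n₀+1) ≥ 32 e^τ C`, the interval count
`J = ⌊√(N+1)/(4 e^τ C)⌋`, apply S6's domination with `κ = C/√(N+1)` (valid by S1) and S2. -/
theorem WindowExtinction_of : WindowExtinction := by
  intro Nf hNf
  obtain ⟨reg, hMS, hAS, hCap, hBr, M₀, hM₀, c, hc, H⟩ := stub_wallCellDomination Nf hNf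
  refine ⟨reg, hMS, hAS, hCap, hBr, M₀, hM₀, c, hc, fun m hm => ⟨(H m hm).1, ?_⟩⟩
  obtain ⟨p, hp, τ, hτ, c₂, hc₂, Hdom⟩ := (H m hm).2
  obtain ⟨C, hC, hLO⟩ := stub_erdosLittlewoodOfford p hp
  -- constants
  set E : ℝ := Real.exp τ * C with hE
  have hEpos : 0 < E := mul_pos (Real.exp_pos τ) hC
  refine ⟨c₂ / (32 * E), div_pos hc₂ (by positivity), fun M hM => ?_⟩
  -- the threshold on the number of cells
  obtain ⟨n₀, hn₀⟩ : ∃ n₀ : ℕ, (32 * E) ^ 2 ≤ (n₀ : ℝ) := exists_nat_ge _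
  have hside := (tendsto_side reg).eventually_ge_atTop (Real.sqrt (32 * E / c₂))
  filter_upwards [Hdom M hM n₀, hside] with k hk hks
  obtain ⟨N, hNn₀, d, hd, hscale, hdom⟩ := hk
  -- abbreviations
  set μ := wilsonMeasure (d := 4) (L := 2 * reg.L k + 1) (fundamentalRep (Fin 3)) (reg.β k) with hμ
  set w : GaugeConfig 4 (2 * reg.L k + 1) (Matrix.specialUnitaryGroup (Fin 3) ℂ) → ℝ :=
    fun U => ∏ f : Fin Nf, ‖fermionDet (wilsonDirac (fundamentalRep (Fin 3)) U (reg.mcrit k + reg.a k * m f / reg.Zm k) 1)‖ with hw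
  set X : GaugeConfig 4 (2 * reg.L k + 1) (Matrix.specialUnitaryGroup (Fin 3) ℂ) → ℤ :=
    fun U => ((Multiset.countP (fun z : ℂ => z.re < 0) (spinorLift gammaFive * wilsonDirac (fundamentalRep (Fin 3)) U (reg.mcrit k - reg.a k * M / reg.Zm k) 1).charpoly.roots : ℕ) : ℤ) - 6 * (2 * (reg.L k : ℤ) + 1) ^ 4 with hX
  set ℓ : ℝ := reg.a k * (2 * reg.L k + 1 : ℝ) with hℓ
  set Z : ℝ := ∫ U, w U ∂μ with hZdef
  -- regularity of the weight and of the index (Literature `QCDPhaseQuenched` + S7)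
  have hw0 : ∀ U, 0 ≤ w U := fun U => Finset.prod_nonneg fun f _ => norm_nonneg _
  have hZ : 0 < Z := by
    have h := integral_norm_det_diracMatrix_pos_all (S := 2 * reg.L k + 1) (reg.β k)
      (fun f : Fin Nf => reg.mcrit k + reg.a k * m f / reg.Zm k)
    refine h.trans_eq (integral_congr_ae (Eventually.of_forall fun U => ?_))
    simp only [hw, norm_det_diracMatrix]
  have hwint : Integrable w μ := by
    have h := integrable_norm_det_diracMatrix (S := 2 * reg.L k + 1)
      (fun f : Fin Nf => reg.mcrit k + reg.a k * m f / reg.Zm k) μ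
    refine h.congr (Eventually.of_forall fun U => ?_)
    simp only [hw, norm_det_diracMatrix]
  have hXmeas : Measurable X := by
    have h := stub_indexMeasurable (2 * reg.L k + 1) (reg.mcrit k - reg.a k * M / reg.Zm k)
    exact (measurable_from_top (f := fun n : ℕ => (n : ℤ) - 6 * (2 * (reg.L k : ℤ) + 1) ^ 4)).comp h
  have hXbound : ∀ U, |(X U : ℝ)| ≤
      (Fintype.card (TorusSite 4 (2 * reg.L k + 1) × Fin 3 × Fin 4) : ℝ) + 6 * (2 * (reg.L k : ℝ) + 1) ^ 4 := by
    intro U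
    set A := spinorLift gammaFive * wilsonDirac (fundamentalRep (Fin 3)) U (reg.mcrit k - reg.a k * M / reg.Zm k) 1
      with hA
    have h1 : Multiset.countP (fun z : ℂ => z.re < 0) A.charpoly.roots ≤
        Fintype.card (TorusSite 4 (2 * reg.L k + 1) × Fin 3 × Fin 4) :=
      calc Multiset.countP (fun z : ℂ => z.re < 0) A.charpoly.roots
          ≤ Multiset.card A.charpoly.roots := Multiset.countP_le_card _ _
        _ ≤ A.charpoly.natDegree := Polynomial.card_roots' _
        _ = Fintype.card (TorusSite 4 (2 * reg.L k + 1) × Fin 3 × Fin 4) := Matrix.charpoly_natDegree_eq_dim _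
    have h1' : ((Multiset.countP (fun z : ℂ => z.re < 0) A.charpoly.roots : ℕ) : ℝ) ≤
        Fintype.card (TorusSite 4 (2 * reg.L k + 1) × Fin 3 × Fin 4) := by exact_mod_cast h1
    have h0 : (0 : ℝ) ≤ (Multiset.countP (fun z : ℂ => z.re < 0) A.charpoly.roots : ℕ) := Nat.cast_nonneg _
    have h6 : (0 : ℝ) ≤ 6 * (2 * (reg.L k : ℝ) + 1) ^ 4 := by positivity
    simp only [hX]
    push_cast
    rw [abs_le]
    constructor <;> linarith
  have hXwint : Integrable (fun U => |(X U : ℝ)| * w U) μ := by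
    have hXr : Measurable fun U => |(X U : ℝ)| :=
      (measurable_from_top (f := fun n : ℤ => |(n : ℝ)|)).comp hXmeas
    refine (hwint.const_mul ((Fintype.card (TorusSite 4 (2 * reg.L k + 1) × Fin 3 × Fin 4) : ℝ) +
      6 * (2 * (reg.L k : ℝ) + 1) ^ 4)).mono' (hXr.aestronglyMeasurable.mul hwint.aestronglyMeasurable) ?_
    exact Eventually.of_forall fun U => by
      rw [Real.norm_eq_abs, abs_mul, abs_abs, abs_of_nonneg (hw0 U)]
      exact mul_le_mul_of_nonneg_right (hXbound U) (hw0 U)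
  -- κ from S1 and the cell threshold
  have hN1 : (0 : ℝ) < Real.sqrt (N + 1) := Real.sqrt_pos.2 (by positivity)
  have hsqrtN : 32 * E ≤ Real.sqrt (N + 1) := by
    have h1 : (32 * E) ^ 2 ≤ (N : ℝ) + 1 := by
      have : (n₀ : ℝ) ≤ N := by exact_mod_cast hNn₀
      linarith
    calc 32 * E = Real.sqrt ((32 * E) ^ 2) := by rw [Real.sqrt_sq (by positivity)]
      _ ≤ Real.sqrt (N + 1) := Real.sqrt_le_sqrt h1
  set κ : ℝ := C / Real.sqrt (N + 1) with hκ
  have hκ0 : 0 ≤ κ := div_nonneg hC.le hN1.le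
  have hSC := hLO N d hd
  -- the interval count
  set J : ℕ := ⌊Real.sqrt (N + 1) / (4 * E)⌋₊ with hJ
  have hJle : (J : ℝ) ≤ Real.sqrt (N + 1) / (4 * E) := Nat.floor_le (by positivity)
  have hJge : Real.sqrt (N + 1) / (4 * E) - 1 ≤ (J : ℝ) := (Nat.sub_one_lt_floor _).le
  have hJκ : (J : ℝ) * (Real.exp τ * κ) ≤ 1 / 4 := by
    have : (J : ℝ) * (Real.exp τ * κ) = J * E / Real.sqrt (N + 1) := by
      simp only [hκ, hE]; ring
    rw [this, div_le_iff₀ hN1]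
    have := mul_le_mul_of_nonneg_right hJle hEpos.le
    calc (J : ℝ) * E ≤ Real.sqrt (N + 1) / (4 * E) * E := this
      _ = 1 / 4 * Real.sqrt (N + 1) := by field_simp
  -- S6's domination at κ, then S2
  have hwin := hdom κ hκ0 hSC
  have hmom := stub_windowToMoment μ w X d J (Real.exp τ * κ) (1 / 4) hd
    (mul_nonneg (Real.exp_pos τ).le hκ0) (by norm_num) (by linarith) hw0 hXmeas hwint hXwint
    (fun x => hwin x J)
  -- arithmetic: ((Jd/2 − 1)(1 − 1/4 − Jκe^τ)) ≥ d √(N+1) / (32 E) ≥ c₂ ℓ² / (32 E)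
  have hd1 : (1 : ℝ) ≤ d := by exact_mod_cast hd
  have hfac1 : (1 : ℝ) / 2 ≤ 1 - 1 / 4 - (J : ℝ) * (Real.exp τ * κ) := by linarith
  have hfac2 : (d : ℝ) * Real.sqrt (N + 1) / (16 * E) ≤ (J * d : ℝ) / 2 - 1 := by
    -- J d/2 − 1 ≥ (√(N+1)/(4E) − 1) d/2 − 1 = d√(N+1)/(8E) − d/2 − 1 ≥ d√(N+1)/(8E) − 3d/2
    --            ≥ d√(N+1)/(8E) − (3/8)·(d√(N+1)/(8E))·... use √(N+1) ≥ 32E: d ≤ d√(N+1)/(32E)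
    have h1 : (Real.sqrt (N + 1) / (4 * E) - 1) * d ≤ (J : ℝ) * d :=
      mul_le_mul_of_nonneg_right hJge (by positivity)
    have h2 : (d : ℝ) ≤ d * Real.sqrt (N + 1) / (32 * E) := by
      rw [le_div_iff₀ (by positivity)]
      have := mul_le_mul_of_nonneg_left hsqrtN (show (0 : ℝ) ≤ d by positivity)
      linarith
    have h3 : (1 : ℝ) ≤ d * Real.sqrt (N + 1) / (32 * E) := hd1.trans h2
    have h4 : (Real.sqrt (N + 1) / (4 * E) - 1) * d = d * Real.sqrt (N + 1) / (32 * E) * 8 - d := by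
      field_simp; ring
    have h5 : (d : ℝ) * Real.sqrt (N + 1) / (16 * E) = 2 * (d * Real.sqrt (N + 1) / (32 * E)) := by
      field_simp; ring
    rw [h4] at h1
    rw [h5]
    linarith [h1, h2, h3]
  have hprod : (d : ℝ) * Real.sqrt (N + 1) / (32 * E) ≤
      ((J * d : ℝ) / 2 - 1) * (1 - 1 / 4 - (J : ℝ) * (Real.exp τ * κ)) := by
    have hpos : (0 : ℝ) ≤ (d : ℝ) * Real.sqrt (N + 1) / (16 * E) := by positivity
    calc (d : ℝ) * Real.sqrt (N + 1) / (32 * E) = (d * Real.sqrt (N + 1) / (16 * E)) * (1 / 2) := by ring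
      _ ≤ ((J * d : ℝ) / 2 - 1) * (1 - 1 / 4 - (J : ℝ) * (Real.exp τ * κ)) :=
          mul_le_mul hfac2 hfac1 (by norm_num) (hpos.trans hfac2)
  have hfloor : c₂ / (32 * E) * ℓ ^ 2 * Z ≤ ∫ U, |(X U : ℝ)| * w U ∂μ := by
    have hZ0 : 0 ≤ Z := integral_nonneg hw0
    have h1 : c₂ / (32 * E) * ℓ ^ 2 ≤ (d : ℝ) * Real.sqrt (N + 1) / (32 * E) := by
      rw [div_mul_eq_mul_div, div_le_div_iff_of_pos_right (by positivity)]
      exact hscale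
    calc c₂ / (32 * E) * ℓ ^ 2 * Z ≤ (d : ℝ) * Real.sqrt (N + 1) / (32 * E) * Z :=
          mul_le_mul_of_nonneg_right h1 hZ0
      _ ≤ ((J * d : ℝ) / 2 - 1) * (1 - 1 / 4 - (J : ℝ) * (Real.exp τ * κ)) * Z :=
          mul_le_mul_of_nonneg_right hprod hZ0
      _ ≤ ∫ U, |(X U : ℝ)| * w U ∂μ := hmom
  -- `max 1 (η ℓ²) = η ℓ²` for large `k`
  have hηℓ : 1 ≤ c₂ / (32 * E) * ℓ ^ 2 := by
    have h0 : 0 ≤ Real.sqrt (32 * E / c₂) := Real.sqrt_nonneg _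
    have h1 : Real.sqrt (32 * E / c₂) ^ 2 ≤ ℓ ^ 2 := pow_le_pow_left₀ h0 hks 2
    rw [Real.sq_sqrt (by positivity)] at h1
    rw [div_mul_eq_mul_div, le_div_iff₀ (by positivity)]
    have := mul_le_mul_of_nonneg_left h1 hc₂.le
    field_simp at this
    linarith
  rw [max_eq_right hηℓ, le_div_iff₀ hZ]
  -- identify the integrand of the route file with `|X| * w`
  have hint : ∫ U, |(X U : ℝ)| * w U ∂μ =
      ∫ U, (|(Multiset.countP (fun z : ℂ => z.re < 0) (spinorLift gammaFive * wilsonDirac (fundamentalRep (Fin 3)) U (reg.mcrit k - reg.a k * M / reg.Zm k) 1).charpoly.roots : ℝ) - 6 * (2 * reg.L k + 1 : ℝ) ^ 4|) * ∏ f : Fin Nf, ‖fermionDet (wilsonDirac (fundamentalRep (Fin 3)) U (reg.mcrit k + reg.a k * m f / reg.Zm k) 1)‖ ∂μ := by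
    refine integral_congr_ae (Eventually.of_forall fun U => ?_)
    simp only [hX, hw]
    push_cast
    ring_nf
  rw [← hint]
  exact hfloor

end Summit.QuantumFields.QCD.Cruxes.WindowExtinction.WallConditionedCellSpread

end
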